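import Literature.Topology.FourManifolds.MappingTorus
import Literature.Topology.FourManifolds.MappingTorusFibreTwist
import Literature.Topology.FourManifolds.SurgeredMappingTorus
import Literature.Topology.FourManifolds.CircleSurgery
import Literature.Topology.FourManifolds.CerfGammaFourProofs
import Literature.Topology.FourManifolds.Diffeotopy
import HarnessLib

/-!
# drefute evidence — the two GLUE stubs of line `monodromy-kernel-engine` are TRUE (proved here)

Crux item stmt-SmoothPoincare4-0366 (`ZeroSurgeryExotic.ZseCruxRasmussen` = `Literature.Uncategorized.Crux`),
line `Cruxes/ZseCruxRasmussen/Lines/monodromy-kernel-engine.lean`.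

`stub_mappingTorus_isotopy_proof` and `stub_mappingTorus_conj_proof` below have, LETTER FOR LETTER, the
types of the skeleton's `stub_mappingTorus_isotopy` / `stub_mappingTorus_conj` (full model generality:
any model with corners `I` on the fibre, any `IT` on the total space, no Hausdorff / second-countability),
and are sorry-free over proved tree API:

* isotopy: `IsOpenGluingWith.fibreTwist_of_eq` (MappingTorusFibreTwist.lean, generic fibre) applied to the
  stagewise INVERSE `D.inv` of a diffeotopy `D` with `D.stage 1 = φ.symm.trans ψ` (so `D.inv₁ = φ ∘ ψ⁻¹`);
* conjugation: precompose both gluing embeddings with `g × id` (`Manifold.IsSmoothEmbedding.comp_diffeomorph`,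
  `mappingTorusRel_prodMap_iff'`), verbatim the tree template `IsSurgeredMappingTorusOf.conj` without the
  section circle.

Refuter verdict for these two stubs: SURVIVED (true; candidate proofs for the lead to paste).
-/

noncomputable section

set_option linter.dupNamespace false

open scoped Manifold ContDiff Topology
open Set Function
open Literature.Topology.FourManifolds

namespace Summit.SmoothPoincare4.SmoothPoincare4.Cruxes.ZseCruxRasmussen.MonodromyKernelEngine.Drefute

/-- **Stub 1 of the line, proved** (isotopy invariance of smooth mapping tori, relational form):
same statement as `stub_mappingTorus_isotopy`. [folklore] -/
theorem stub_mappingTorus_isotopy_proof :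
    ∀ {E H : Type*} [NormedAddCommGroup E] [NormedSpace ℝ E] [TopologicalSpace H]
      {I : ModelWithCorners ℝ E H}
      {ET HT : Type*} [NormedAddCommGroup ET] [NormedSpace ℝ ET] [TopologicalSpace HT]
      {IT : ModelWithCorners ℝ ET HT}
      {M : Type*} [TopologicalSpace M] [ChartedSpace H M] [IsManifold I ∞ M]
      {T : Type*} [TopologicalSpace T] [ChartedSpace HT T] [IsManifold IT ∞ T]
      (φ ψ : M ≃ₘ⟮I, I⟯ M),
      Diffeomorph.IsDiffeotopic φ ψ → IsMappingTorusOf IT T φ → IsMappingTorusOf IT T ψ := by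
  intro E H _ _ _ I ET HT _ _ _ IT M _ _ _ T _ _ _ φ ψ hD h
  obtain ⟨D, hD⟩ := hD
  obtain ⟨jA, jB, hW⟩ := h
  -- `D_1 = ψ ∘ φ⁻¹`, hence `D.inv₁ = φ ∘ ψ⁻¹`
  have hD1 : ∀ y, D.toFun 1 y = ψ (φ.symm y) := fun y => by
    have := congrArg (fun χ : M ≃ₘ⟮I, I⟯ M => χ y) hD
    simpa using this
  have hDinv1 : ∀ x, D.inv.toFun 1 x = φ (ψ.symm x) := fun x => by
    rw [Diffeotopy.inv_toFun]
    have h1 : D.toFun 1 (φ (ψ.symm x)) = x := by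
      rw [hD1, Diffeomorph.symm_apply_apply, Diffeomorph.apply_symm_apply]
    conv_lhs => rw [← h1]
    rw [Diffeotopy.invFun_toFun]
  exact (IsOpenGluingWith.fibreTwist_of_eq φ D.inv hW ψ hDinv1).isOpenGluing

/-- **Stub 2 of the line, proved** (conjugation invariance of smooth mapping tori, relational form):
same statement as `stub_mappingTorus_conj`. [folklore] -/
theorem stub_mappingTorus_conj_proof :
    ∀ {E H : Type*} [NormedAddCommGroup E] [NormedSpace ℝ E] [TopologicalSpace H]
      {I : ModelWithCorners ℝ E H}
      {ET HT : Type*} [NormedAddCommGroup ET] [NormedSpace ℝ ET] [TopologicalSpace HT]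
      {IT : ModelWithCorners ℝ ET HT}
      {M : Type*} [TopologicalSpace M] [ChartedSpace H M] [IsManifold I ∞ M]
      {T : Type*} [TopologicalSpace T] [ChartedSpace HT T] [IsManifold IT ∞ T]
      (φ g : M ≃ₘ⟮I, I⟯ M),
      IsMappingTorusOf IT T φ → IsMappingTorusOf IT T ((g.trans φ).trans g.symm) := by
  intro E H _ _ _ I ET HT _ _ _ IT M _ _ _ T _ _ _ φ g h
  obtain ⟨jA, jB, hA, hAo, hB, hBo, hU, hR⟩ := h
  have h1 : Function.Surjective
      (Prod.map g (id : ↥mappingTorusPieceOne → ↥mappingTorusPieceOne)) :=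
    (EquivLike.surjective g).prodMap Function.surjective_id
  have h2 : Function.Surjective
      (Prod.map g (id : ↥mappingTorusPieceTwo → ↥mappingTorusPieceTwo)) :=
    (EquivLike.surjective g).prodMap Function.surjective_id
  have hψ : ∀ x, g (((g.trans φ).trans g.symm) x) = φ (g x) := fun x => by simp
  refine ⟨jA ∘ Prod.map g id, jB ∘ Prod.map g id, ?_, ?_, ?_, ?_, ?_, fun a b => ?_⟩
  · have := hA.comp_diffeomorph (g.prodCongr (Diffeomorph.refl 𝓘(ℝ, ℝ) ↥mappingTorusPieceOne ∞))
    simpa only [Diffeomorph.coe_prodCongr, Diffeomorph.coe_refl] using this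
  · rwa [h1.range_comp]
  · have := hB.comp_diffeomorph (g.prodCongr (Diffeomorph.refl 𝓘(ℝ, ℝ) ↥mappingTorusPieceTwo ∞))
    simpa only [Diffeomorph.coe_prodCongr, Diffeomorph.coe_refl] using this
  · rwa [h2.range_comp]
  · rwa [h1.range_comp, h2.range_comp]
  · rw [Function.comp_apply, Function.comp_apply, hR]
    exact mappingTorusRel_prodMap_iff' (EquivLike.injective g) hψ a b

end Summit.SmoothPoincare4.SmoothPoincare4.Cruxes.ZseCruxRasmussen.MonodromyKernelEngine.Drefute

end
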